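import Summits.QuantumFields.YangMills.Theses.SlowBitWindow
import Summits.QuantumFields.YangMills.Theorems.SlowBitWindowInsertionTraceSpectral
import HarnessLib

/-!
# SlowBitWindow — the support item `JensenDoor` (stmt-QuantumFields-23274), proved

`jensenDoor_proof : Theses.SlowBitWindow.JensenDoor`: for `L ≥ 2`, `β ≥ 1` and every physical observable `O` with `|O| ≤ 1`,
`(insTrace L β O 1)^L ≤ insTrace L β O L · Z_phys(L, β, 2L)^(L-1)`.

Proof (D-0145 LINE g10-A of seat ym-idea-4, the planner's power-mean sketch made rigorous without real powers).  By the spectral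
representation `insTrace_spectral`, `insTrace L β O 1 = Σ w r` and `insTrace L β O L = Σ w r^L` over `(k,l) ∈ ℕ × ℕ` with weights
`w_{kl} = λ_k^{2L} c_{kl} ≥ 0` (`c_{kl} = (∫ O e_k e_l)²`) and ratios `r_{kl} = λ_l / λ_k > 0` (all `λ_k > 0`, `levelValue_su2Rep_pos`).
The TANGENT-LINE form of Jensen's inequality for `x ↦ x^L` — `x^L ≥ s^L + L s^{L-1} (x - s)` for `x, s ≥ 0` (Bernoulli) — summed with the
weights at `s = (Σ w r)/(Σ w)` gives `(Σ w r)^L ≤ (Σ w)^{L-1} Σ w r^L`, and `Σ w = Σ_k λ_k^{2L} Σ_l c_{kl} ≤ Σ_k λ_k^{2L} = Z_phys(2L)`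
(row bound `Σ_l c_{kl} ≤ 1`, trace formula `TT.traceFormula_all`).  Route-independent imports only (the route file itself and the
spectral support module), so that no other route's edits rebuild this file.

HONEST FRAMING: an M-sized spectral support item of a DRAFT line onto the RECORD rung K2a (`ThermalTraceWindow.SubFemtoFirstLevel`);
fixed-lattice transfer-matrix theory; no summit, no mass gap, nothing about infinite volume or the continuum is proved here.
References: [cite: ReedSimonIV1978, Thm. XIII.1]; [cite: MadrasSokal1988, §2].
-/

set_option autoImplicit false

noncomputable section

open MeasureTheory Filter Topology Function
open Literature.MathematicalPhysics.QuantumFieldTheory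
open Literature.MathematicalPhysics.QuantumLattice
open Literature.Analysis.OperatorTheory.YMMatrixModel
open scoped BigOperators

namespace Summit.QuantumFields.YangMills.Theorems.SlowBitWindow

open Summit.QuantumFields.YangMills.Theorems.FemtoTransferGap
open Summit.QuantumFields.YangMills.Theorems.FemtoTransferGap.TT

/-! ## §1 The tangent line of `x ↦ x^L` -/

/-- **Tangent-line (Bernoulli) inequality**: `s^L + L s^{L-1} (x - s) ≤ x^L` for `0 ≤ x`, `0 ≤ s` (convexity of `x ↦ x^L` on `[0, ∞)`).
[folklore] -/
theorem pow_tangent_le (L : ℕ) {x s : ℝ} (hx : 0 ≤ x) (hs : 0 ≤ s) :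
    s ^ L + L * s ^ (L - 1) * (x - s) ≤ x ^ L := by
  rcases Nat.eq_zero_or_pos L with hL | hL
  · subst hL; simp
  rcases hs.eq_or_lt with hs0 | hs0
  · subst hs0
    rcases Nat.eq_or_lt_of_le hL with hL1 | hL1
    · subst hL1; simp
    · rw [zero_pow (by omega), zero_pow (by omega)]; simpa using pow_nonneg hx L
  · -- `x = s (1 + t)` with `t = x/s - 1 ≥ -1`
    set t : ℝ := x / s - 1 with ht
    have hxt : x = s * (1 + t) := by rw [ht]; field_simp; ring
    have ht2 : -2 ≤ t := by
      have : 0 ≤ x / s := div_nonneg hx hs0.le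
      rw [ht]; linarith
    have hB := one_add_mul_le_pow ht2 L
    have hsL : s ^ L = s * s ^ (L - 1) := by
      rw [← pow_succ']; congr 1; omega
    calc s ^ L + L * s ^ (L - 1) * (x - s) = s ^ L * (1 + L * t) := by
          rw [hxt, hsL]; ring
      _ ≤ s ^ L * (1 + t) ^ L := mul_le_mul_of_nonneg_left hB (pow_nonneg hs0.le L)
      _ = x ^ L := by rw [hxt, mul_pow]

/-! ## §2 The door -/

/-- **`JensenDoor` holds** (item stmt-QuantumFields-23274 of route `SlowBitWindow`): for `L ≥ 2`, `β ≥ 1` and a physical observable `O` with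
`|O| ≤ 1`, `(insTrace L β O 1)^L ≤ insTrace L β O L · (physTrace L β (2L))^(L-1)`. [cite: ReedSimonIV1978, Thm. XIII.1] [cite: MadrasSokal1988, §2] -/
theorem jensenDoor_proof : Summit.QuantumFields.YangMills.Theses.SlowBitWindow.JensenDoor := by
  intro L _ hL β hβ O hO hOb
  have hβ0 : 0 < β := zero_lt_one.trans_le hβ
  obtain ⟨e, hphys, -, -, -, hbessel, hsum⟩ := insTrace_spectral (L := L) hβ0 hO (CO := 1) hOb
  -- notation
  set lam : ℕ → ℝ := fun k => levelValue su2Rep L β k with hlamdef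
  set c : ℕ → ℕ → ℝ := fun k l => (∫ U, O U * e k U * e l U ∂configMeasure FemtoTransferGap.SU2 L) ^ 2 with hcdef
  have hlam : ∀ k, 0 < lam k := fun k => levelValue_su2Rep_pos hβ0 k
  have hc0 : ∀ k l, 0 ≤ c k l := fun k l => sq_nonneg _
  have hbessel' : ∀ k, Summable (c k) ∧ ∑' l, c k l ≤ 1 := fun k => by
    have h := hbessel k; rw [one_pow] at h; exact h
  -- weights `w`, one-step family `F1 = w r`, antipodal family `FL = w r^L`, `r = λ_l / λ_k`
  set w : ℕ × ℕ → ℝ := fun p => lam p.1 ^ (2 * L) * c p.1 p.2 with hwdef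
  set r : ℕ × ℕ → ℝ := fun p => lam p.2 / lam p.1 with hrdef
  set F1 : ℕ × ℕ → ℝ := fun p => lam p.1 ^ (2 * L - 1) * lam p.2 ^ 1 * c p.1 p.2 with hF1def
  set FL : ℕ × ℕ → ℝ := fun p => lam p.1 ^ (2 * L - L) * lam p.2 ^ L * c p.1 p.2 with hFLdef
  have hw0 : ∀ p, 0 ≤ w p := fun p => mul_nonneg (pow_nonneg (hlam _).le _) (hc0 _ _)
  have hr0 : ∀ p, 0 ≤ r p := fun p => div_nonneg (hlam _).le (hlam _).le
  have hF1w : ∀ p, F1 p = w p * r p := fun p => by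
    simp only [hF1def, hwdef, hrdef]
    have hk : lam p.1 ≠ 0 := (hlam p.1).ne'
    have e1 : lam p.1 ^ (2 * L) = lam p.1 ^ (2 * L - 1) * lam p.1 := by
      rw [← pow_succ]; congr 1; omega
    rw [e1]; field_simp
  have hFLw : ∀ p, FL p = w p * r p ^ L := fun p => by
    simp only [hFLdef, hwdef, hrdef]
    have hk : lam p.1 ≠ 0 := (hlam p.1).ne'
    have e1 : lam p.1 ^ (2 * L) = lam p.1 ^ (2 * L - L) * lam p.1 ^ L := by
      rw [← pow_add]; congr 1; omega
    rw [e1, div_pow]; field_simp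
  -- the three sums
  have hS1 : HasSum F1 (insTrace L β O 1) := hsum 1 le_rfl (by omega)
  have hSL : HasSum FL (insTrace L β O L) := hsum L (by omega) (by omega)
  have htr : HasSum (fun k => lam k ^ (2 * L)) (physTrace L β (2 * L)) := traceFormula L β (2 * L) hβ (by omega)
  -- `w` is summable with `Σ w ≤ Z(2L)` (row bound `Σ_l c_{kl} ≤ 1`)
  have hrow : ∀ k, HasSum (fun l => w (k, l)) (lam k ^ (2 * L) * ∑' l, c k l) := fun k =>
    ((hbessel' k).1.hasSum).mul_left (lam k ^ (2 * L))
  have hg0 : ∀ k, 0 ≤ lam k ^ (2 * L) * ∑' l, c k l := fun k => mul_nonneg (pow_nonneg (hlam k).le _) (tsum_nonneg (hc0 k))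
  have hgle : ∀ k, lam k ^ (2 * L) * ∑' l, c k l ≤ lam k ^ (2 * L) := fun k => by
    have h := mul_le_mul_of_nonneg_left (hbessel' k).2 (pow_nonneg (hlam k).le (2 * L))
    rwa [mul_one] at h
  have hgs : Summable fun k => lam k ^ (2 * L) * ∑' l, c k l := Summable.of_nonneg_of_le hg0 hgle htr.summable
  have hWs : Summable w := by
    refine (summable_prod_of_nonneg hw0).mpr ⟨fun k => (hrow k).summable, ?_⟩
    exact hgs.congr fun k => ((hrow k).tsum_eq).symm
  have hWle : ∑' p : ℕ × ℕ, w p ≤ physTrace L β (2 * L) := by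
    rw [← (hWs.hasSum.prod_fiberwise hrow).tsum_eq, ← htr.tsum_eq]
    exact hgs.tsum_le_tsum hgle htr.summable
  set SW : ℝ := ∑' p : ℕ × ℕ, w p with hSWdef
  have hW : HasSum w SW := hWs.hasSum
  have hSW0 : 0 ≤ SW := tsum_nonneg hw0
  have hI1_0 : 0 ≤ insTrace L β O 1 :=
    hS1.nonneg (fun p => by rw [hF1w]; exact mul_nonneg (hw0 p) (hr0 p))
  have hIL_0 : 0 ≤ insTrace L β O L :=
    hSL.nonneg (fun p => by rw [hFLw]; exact mul_nonneg (hw0 p) (pow_nonneg (hr0 p) L))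
  -- the power-mean inequality `(Σ w r)^L ≤ (Σ w)^(L-1) Σ w r^L`
  have hkey : insTrace L β O 1 ^ L ≤ insTrace L β O L * SW ^ (L - 1) := by
    rcases hSW0.eq_or_lt with hSW | hSW
    · -- all weights vanish
      have hw00 : ∀ p, w p = 0 := fun p => by
        have h := (hasSum_zero_iff_of_nonneg hw0).mp (hSW ▸ hW)
        exact congrFun h p
      have hI1 : insTrace L β O 1 = 0 := by
        have h : F1 = fun _ => 0 := funext fun p => by rw [hF1w, hw00, zero_mul]
        rw [h] at hS1
        exact hS1.unique hasSum_zero ▸ rfl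
      rw [hI1, zero_pow (by omega)]
      exact mul_nonneg hIL_0 (pow_nonneg hSW0 _)
    · set s : ℝ := insTrace L β O 1 / SW with hsdef
      have hs0 : 0 ≤ s := div_nonneg hI1_0 hSW.le
      -- sum the tangent inequality `w (s^L + L s^(L-1) (r - s)) ≤ w r^L`
      have hdom : ∀ p, w p * s ^ L + (L : ℝ) * s ^ (L - 1) * (w p * r p - s * w p) ≤ FL p := fun p => by
        rw [hFLw]
        have h := mul_le_mul_of_nonneg_left (pow_tangent_le L (hr0 p) hs0) (hw0 p)
        nlinarith [h]
      have hG : HasSum (fun p => w p * s ^ L + (L : ℝ) * s ^ (L - 1) * (w p * r p - s * w p))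
          (SW * s ^ L + (L : ℝ) * s ^ (L - 1) * (insTrace L β O 1 - s * SW)) := by
        refine (hW.mul_right (s ^ L)).add (((hS1.congr_fun fun p => (hF1w p).symm).sub (hW.mul_left s)).mul_left _)
      have hle := hasSum_le hdom hG hSL
      have hcancel : insTrace L β O 1 - s * SW = 0 := by rw [hsdef]; field_simp; ring
      rw [hcancel, mul_zero, add_zero] at hle
      -- `SW s^L = I1^L / SW^(L-1)`
      have hSWpow : SW * s ^ L * SW ^ (L - 1) = insTrace L β O 1 ^ L := by
        rw [hsdef, div_pow]
        have hSWL : SW ^ L = SW * SW ^ (L - 1) := by rw [← pow_succ']; congr 1; omega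
        rw [hSWL]; field_simp
      calc insTrace L β O 1 ^ L = SW * s ^ L * SW ^ (L - 1) := hSWpow.symm
        _ ≤ insTrace L β O L * SW ^ (L - 1) := mul_le_mul_of_nonneg_right hle (pow_nonneg hSW0 _)
  calc insTrace L β O 1 ^ L ≤ insTrace L β O L * SW ^ (L - 1) := hkey
    _ ≤ insTrace L β O L * physTrace L β (2 * L) ^ (L - 1) :=
        mul_le_mul_of_nonneg_left (pow_le_pow_left₀ hSW0 hWle _) hIL_0

end Summit.QuantumFields.YangMills.Theorems.SlowBitWindow

end
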